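import Summits.QuantumFields.YangMills.Theorems.BalabanUVNodesN08HaarCompatibilityGuardHybridFresh

/-!
# BalabanUVNodes ∕ N08 — THE CANONICAL FAR SET OF A FINSET `S` OF COARSE BONDS: every coarse bond with an END BLOCK outside the end blocks `Blk(S)` of `S` is fresh under
# the hybrid averaging `Ū^S` (select the first ∕ last bond of its line); hence the transported guarded part is a function of the coarse bonds with BOTH END BLOCKS IN `Blk(S)`
# — (G1) locality in ready-to-use form

WIDTH SEAT `pub-ymgap-dag-n08-w3` g7, item-3 lineage PART 37 (successor of part 35 `…GuardHybridFresh`, whose abstract far set (`Far`, `τ`, «selected bond outside the end blocks of `S`») it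
instantiates canonically; through part 35 it consumes n08-w1 g6's abstract-Φ freshness `…N08CoarseGrainingFarFresh` BY IMPORT), 2026-08-28.  Track A, DAG node N08 = [Balaban1985UV3] Thm 1 p. 257 (compact) + Thm 2 p. 272; key item K1⁷
`StabilityBAtRecordR13SepCoPH` (stmt-QuantumFields-20542), `--supports … --as helper`.  COUNT-NEUTRAL.

THE POINT (located; n08-w1 g6 `N08-NO-STACKING-MECHANISM.md` §3 (G1): «`B_{j,c}` LOCAL near `c` — a function of the coarse bonds whose lines meet `B(c₋) ∪ B(c₊)`»).  For a finset `S`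
write `Blk(S) = {c.src, c.tgt : c ∈ S}` (inline: `S.image src ∪ S.image tgt`).  The CANONICAL far set is `Far_S = {c′ | c′.src ∉ Blk(S) ∨ c′.tgt ∉ Blk(S)}` with the selection
`τ_S c′ = 0` if `c′.src ∉ Blk(S)` (the first bond of the line issues from the centre of `B(c′₋)`), else `τ_S c′ = L − 1` (the last bond issues from `B(c′₊)`).  Then the
hypotheses of part 35 hold (§1), every density reading only the bonds issuing from `Blk(S)` — e.g. `1_{G_S}·f` with `f` such — is local off the selection (§2), and so (§3):
**under `(ρ·dU)∘(Ū^S)⁻¹` the coarse variables of ALL bonds with an end block outside `Blk(S)` are product Haar, independent of the rest; the transported density is a function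
of the coarse bonds with BOTH end blocks in `Blk(S)`** — a sharper near set than «lines meeting the blocks» (one free end block already makes a bond fresh).
For `S = {c}`: near = `{c}` alone.

* §1 `blockOf_lineSite_zero` ∕ `blockOf_lineSite_last`, `canonical_tau_lt`, `canonical_selected_not_mem`, `canonical_far_spec` (the part-35 hypothesis `hτS`),
  `not_canonicalFar_iff` (near ⟺ both end blocks in `Blk(S)`).
* §2 `localOff_of_blockLocal`, `small_iff_of_blockLocal` ∕ `guardAll_indicator_blockLocal` (the guard of `S` reads only `Blk(S)`), `blockLocal_mul_guardAll_indicator`.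
* §3 ★★★ `integral_mul_hybrid_canonicalFar_eq` (independence identity), ★★ `integral_mul_comp_hybrid_eq_canonicalFarAvg` (far-average identity), for every integrable density
  reading only the bonds issuing from `Blk(S)`.
* §4 the same at the [B10] slot's averaging `avOfPrint N S₀ j` on `SU(N)`, every `N`, standing range.

HONEST FRAMING.  [folklore] lattice bookkeeping over parts 34∕35 BY IMPORT; nothing of Bałaban's asserted; no density bound (part 36), no cluster expansion, no k-uniform `hmass`
((G2)∕(G3) NOT supplied); E6′ NOT decided; N08 NOT discharged; counts unmoved (typed 28∕28 · discharged 5∕27); one finite 𝕋⁴ programme at fixed ε — R4 closes the CONDITIONAL rung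
`BalabanLadder.UV` only; the Yang–Mills mass gap (Clay) is NOT proved by any of this; nothing continuum ∕ ℝ⁴ ∕ OS.  0 `sorry`, 0 `def`, 0 `instance`, standard axioms.
-/

noncomputable section

open MeasureTheory
open scoped ENNReal

namespace Summit.QuantumFields.YangMills.BalabanUVNodes.N08HaarCompatibilityGuardHybridNearBlocks

open Literature.MathematicalPhysics.QuantumFieldTheory.Balaban1983to89
open Literature.MathematicalPhysics.QuantumFieldTheory.Balaban1983to89.AveragingRT
  (axialAvg measurable_axialAvg line lineSite lineSite_eq_lo lineSite_eq_hi)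
open Literature.MathematicalPhysics.QuantumFieldTheory.Balaban1983to89.BlockAveraging (Small avgFun measurable_avgFun loopHol_local)
open Summit.QuantumFields.Balaban3D.Proofs
open Summit.QuantumFields.YangMills.BalabanUVNodes.N08HaarCompatibilityGuardHybridFresh (integral_mul_hybrid_far_eq integral_mul_comp_hybrid_eq_farAvg)

/-! ## §1 The canonical far set and selection of a finset of coarse bonds -/

section Geometry

variable {P : Params} {j : ℕ}

/-- The first site of the line of `c` (the centre of `B(c₋)`) lies in `B(c₋)`. [folklore] -/
theorem blockOf_lineSite_zero (hj : j + 1 ≤ P.m + P.K) (c : PBond P (j + 1)) : blockOf (lineSite c 0) = c.src := by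
  rw [lineSite_eq_lo hj c (t := 0) (Nat.zero_le _), Site.blockOf_blockSite hj]

/-- The last bond of the line of `c` issues from `B(c₊)` (`L ≥ 3` odd, so `(L−1)∕2 < L − 1`). [folklore] -/
theorem blockOf_lineSite_last (hj : j + 1 ≤ P.m + P.K) (c : PBond P (j + 1)) : blockOf (lineSite c (P.L - 1)) = c.tgt := by
  have hL := P.hL.2
  rw [lineSite_eq_hi hj c (t := P.L - 1) (by omega) (by omega), Site.blockOf_blockSite hj]

/-- The canonical selection is a position `< L`. [folklore] -/
theorem canonical_tau_lt (B : Finset (Site P (j + 1))) (c' : PBond P (j + 1)) : (if c'.src ∉ B then 0 else P.L - 1) < P.L := by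
  have hL := P.hL.2
  split_ifs <;> omega

/-- **THE SELECTED BOND OF A FAR BOND ISSUES FROM A BLOCK OUTSIDE `B`** (`B` any finset of coarse sites; far = an end block outside `B`). [folklore] -/
theorem canonical_selected_not_mem (hj : j + 1 ≤ P.m + P.K) (B : Finset (Site P (j + 1))) (c' : PBond P (j + 1)) (hfar : c'.src ∉ B ∨ c'.tgt ∉ B) :
    blockOf (lineSite c' (if c'.src ∉ B then 0 else P.L - 1)) ∉ B := by
  by_cases h : c'.src ∉ B
  · rw [if_pos h, blockOf_lineSite_zero hj]; exact h
  · rw [if_neg h, blockOf_lineSite_last hj]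
    rcases hfar with h1 | h2
    · exact absurd h1 h
    · exact h2

/-- ★ **THE PART-35 HYPOTHESIS FOR THE CANONICAL FAR SET**: for every far bond `c′` (an end block outside `Blk(S)`) and every `c ∈ S`, the selected bond of `c′` issues neither from
`B(c₋)` nor from `B(c₊)`. [folklore] -/
theorem canonical_far_spec (hj : j + 1 ≤ P.m + P.K) (S : Finset (PBond P (j + 1))) :
    ∀ c', (c'.src ∉ S.image PBond.src ∪ S.image PBond.tgt ∨ c'.tgt ∉ S.image PBond.src ∪ S.image PBond.tgt) → ∀ c ∈ S,
      blockOf (lineSite c' (if c'.src ∉ S.image PBond.src ∪ S.image PBond.tgt then 0 else P.L - 1)) ≠ c.src ∧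
        blockOf (lineSite c' (if c'.src ∉ S.image PBond.src ∪ S.image PBond.tgt then 0 else P.L - 1)) ≠ c.tgt := by
  intro c' hfar c hc
  have h := canonical_selected_not_mem hj (S.image PBond.src ∪ S.image PBond.tgt) c' hfar
  constructor
  · intro heq; exact h (heq ▸ Finset.mem_union_left _ (Finset.mem_image_of_mem _ hc))
  · intro heq; exact h (heq ▸ Finset.mem_union_right _ (Finset.mem_image_of_mem _ hc))

/-- **NEAR ⟺ BOTH END BLOCKS AMONG THE END BLOCKS OF `S`.** [folklore] -/
theorem not_canonicalFar_iff (B : Finset (Site P (j + 1))) (c' : PBond P (j + 1)) :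
    ¬ (c'.src ∉ B ∨ c'.tgt ∉ B) ↔ c'.src ∈ B ∧ c'.tgt ∈ B := by
  rw [not_or, not_not, not_not]

/-- The bonds of `S` themselves are near. [folklore] -/
theorem not_canonicalFar_of_mem (S : Finset (PBond P (j + 1))) {c : PBond P (j + 1)} (hc : c ∈ S) :
    ¬ (c.src ∉ S.image PBond.src ∪ S.image PBond.tgt ∨ c.tgt ∉ S.image PBond.src ∪ S.image PBond.tgt) :=
  (not_canonicalFar_iff _ c).2 ⟨Finset.mem_union_left _ (Finset.mem_image_of_mem _ hc), Finset.mem_union_right _ (Finset.mem_image_of_mem _ hc)⟩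

end Geometry

/-! ## §2 Densities reading only the bonds issuing from `Blk(S)` are local off the canonical selection -/

section BlockLocal

variable {P : Params} {j : ℕ} {G : Type*} [GaugeGroup G] (ℰ : LoopAverage G)

omit [GaugeGroup G] in
/-- **A `B`-BLOCK-LOCAL FUNCTION IS LOCAL OFF THE CANONICAL SELECTION**: if `ρ` reads only the bonds issuing from the blocks of `B`, then `ρ` does not depend on the selected bonds
of the far bonds (those issue from blocks outside `B`, §1). [folklore] -/
theorem localOff_of_blockLocal {X : Type*} (hj : j + 1 ≤ P.m + P.K) (B : Finset (Site P (j + 1))) (ρ : GaugeField P j G → X)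
    (hρ : ∀ W W' : GaugeField P j G, (∀ b : PBond P j, blockOf b.src ∈ B → W b = W' b) → ρ W = ρ W') :
    ∀ W W' : GaugeField P j G,
      (∀ b, (¬ ∃ c' : PBond P (j + 1), (c'.src ∉ B ∨ c'.tgt ∉ B) ∧ line c' (if c'.src ∉ B then 0 else P.L - 1) = b) → W b = W' b) → ρ W = ρ W' := by
  intro W W' hWW'
  refine hρ W W' fun b hb => hWW' b ?_
  rintro ⟨c', hc', rfl⟩
  exact canonical_selected_not_mem hj B c' hc' hb

/-- **THE GUARD OF `S` READS ONLY `Blk(S)`**: `Small ℰ W c ↔ Small ℰ W′ c` for `c ∈ S` whenever `W`, `W′` agree on the bonds issuing from `Blk(S)` (`loopHol_local`). [cite: Balaban1987RG1, (0.4) p.253 (bookkeeping)] -/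
theorem small_iff_of_blockLocal (hj : j + 1 ≤ P.m + P.K) (S : Finset (PBond P (j + 1))) {c : PBond P (j + 1)} (hc : c ∈ S) {W W' : GaugeField P j G}
    (hWW' : ∀ b : PBond P j, blockOf b.src ∈ S.image PBond.src ∪ S.image PBond.tgt → W b = W' b) :
    Small ℰ W c ↔ Small ℰ W' c := by
  have hloc : BlockAveraging.loopHol W c = BlockAveraging.loopHol W' c :=
    loopHol_local hj W W' c fun b hb => hWW' b (by
      rcases hb with h | h
      · exact h ▸ Finset.mem_union_left _ (Finset.mem_image_of_mem _ hc)
      · exact h ▸ Finset.mem_union_right _ (Finset.mem_image_of_mem _ hc))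
  unfold BlockAveraging.Small
  rw [hloc]

/-- The indicator of `G_S = {∀ c ∈ S, Small}` reads only `Blk(S)`. [cite: Balaban1987RG1, (0.4) p.253 (bookkeeping)] -/
theorem guardAll_indicator_blockLocal (hj : j + 1 ≤ P.m + P.K) (S : Finset (PBond P (j + 1))) :
    ∀ W W' : GaugeField P j G, (∀ b : PBond P j, blockOf b.src ∈ S.image PBond.src ∪ S.image PBond.tgt → W b = W' b) →
      {U : GaugeField P j G | ∀ c ∈ S, Small ℰ U c}.indicator (fun _ => (1 : ℝ)) W =
        {U : GaugeField P j G | ∀ c ∈ S, Small ℰ U c}.indicator (fun _ => (1 : ℝ)) W' := by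
  intro W W' hWW'
  have h : (∀ c ∈ S, Small ℰ W c) ↔ (∀ c ∈ S, Small ℰ W' c) :=
    forall₂_congr fun c hc => small_iff_of_blockLocal ℰ hj S hc hWW'
  by_cases hW : ∀ c ∈ S, Small ℰ W c
  · rw [Set.indicator_of_mem (show W ∈ {U : GaugeField P j G | ∀ c ∈ S, Small ℰ U c} from hW),
      Set.indicator_of_mem (show W' ∈ {U : GaugeField P j G | ∀ c ∈ S, Small ℰ U c} from h.1 hW)]
  · rw [Set.indicator_of_notMem (show W ∉ {U : GaugeField P j G | ∀ c ∈ S, Small ℰ U c} from hW),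
      Set.indicator_of_notMem (show W' ∉ {U : GaugeField P j G | ∀ c ∈ S, Small ℰ U c} from fun h' => hW (h.2 h'))]

/-- **THE GUARDED PART OF A BLOCK-LOCAL DENSITY IS BLOCK-LOCAL**: `W ↦ f W · 1_{G_S}(W)` reads only `Blk(S)` if `f` does. [folklore] -/
theorem blockLocal_mul_guardAll_indicator (hj : j + 1 ≤ P.m + P.K) (S : Finset (PBond P (j + 1))) (f : GaugeField P j G → ℝ)
    (hf : ∀ W W' : GaugeField P j G, (∀ b : PBond P j, blockOf b.src ∈ S.image PBond.src ∪ S.image PBond.tgt → W b = W' b) → f W = f W') :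
    ∀ W W' : GaugeField P j G, (∀ b : PBond P j, blockOf b.src ∈ S.image PBond.src ∪ S.image PBond.tgt → W b = W' b) →
      f W * {U : GaugeField P j G | ∀ c ∈ S, Small ℰ U c}.indicator (fun _ => (1 : ℝ)) W =
        f W' * {U : GaugeField P j G | ∀ c ∈ S, Small ℰ U c}.indicator (fun _ => (1 : ℝ)) W' := by
  intro W W' hWW'
  rw [hf W W' hWW', guardAll_indicator_blockLocal ℰ hj S W W' hWW']

end BlockLocal

/-! ## §3 Freshness with the canonical far set: the near set is «both end blocks in `Blk(S)`» -/

section Near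

variable {P : Params} {j : ℕ} {G : Type} [GaugeGroup G] (ℰ : LoopAverage G) [DecidableEq (PBond P (j + 1))] [MeasurableSpace G] [RegularGaugeGroup G] [HaarData G]

/-- ★★★ **ALL COARSE BONDS WITH AN END BLOCK OUTSIDE `Blk(S)` ARE FRESH UNDER `Ū^S`**: for every integrable density `ρ` reading only the bonds issuing from `Blk(S)` (e.g. the guarded
part `f·1_{G_S}` of a `Blk(S)`-local `f`, §2) and all bounded measurable coarse observables `g` reading only the bonds with both end blocks in `Blk(S)` and `f₂` reading only the
other bonds:  **`∫ ρ·g(Ū^S U)·f₂(Ū^S U) dU = (∫ ρ·g(Ū^S U) dU)·(∫ f₂ dV)`** (part 35 at the canonical far set). [cite: Balaban1985UV3, (10) p.258 + (48)–(49) p.268 (bookkeeping); Balaban1985Averaging, (15) p.19; Balaban1987RG1, (0.4) p.253] -/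
theorem integral_mul_hybrid_canonicalFar_eq (hj : j + 1 ≤ P.m + P.K) (hE : ∀ n, Measurable fun W : Fin (n + 1) → G => ℰ.E W) (S : Finset (PBond P (j + 1)))
    (ρ : Density P j G) (hρ : Integrable ρ (fieldMeasure P j G))
    (hloc : ∀ W W' : GaugeField P j G, (∀ b : PBond P j, blockOf b.src ∈ S.image PBond.src ∪ S.image PBond.tgt → W b = W' b) → ρ W = ρ W')
    (g f₂ : GaugeField P (j + 1) G → ℝ) (hg : Measurable g) (hf₂ : Measurable f₂) (Cg C₂ : ℝ) (hCg : ∀ V, |g V| ≤ Cg) (hC₂ : ∀ V, |f₂ V| ≤ C₂)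
    (hlocg : ∀ V V' : GaugeField P (j + 1) G,
      (∀ c, c.src ∈ S.image PBond.src ∪ S.image PBond.tgt ∧ c.tgt ∈ S.image PBond.src ∪ S.image PBond.tgt → V c = V' c) → g V = g V')
    (hloc₂ : ∀ V V' : GaugeField P (j + 1) G,
      (∀ c, (c.src ∉ S.image PBond.src ∪ S.image PBond.tgt ∨ c.tgt ∉ S.image PBond.src ∪ S.image PBond.tgt) → V c = V' c) → f₂ V = f₂ V') :
    ∫ U, ρ U * (g (fun c => if c ∈ S then avgFun ℰ U c else axialAvg U c) * f₂ (fun c => if c ∈ S then avgFun ℰ U c else axialAvg U c))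
        ∂(fieldMeasure P j G) =
      (∫ U, ρ U * g (fun c => if c ∈ S then avgFun ℰ U c else axialAvg U c) ∂(fieldMeasure P j G)) * ∫ V, f₂ V ∂(fieldMeasure P (j + 1) G) := by
  haveI : DecidablePred fun b : PBond P j => ∃ c' : PBond P (j + 1),
      (c'.src ∉ S.image PBond.src ∪ S.image PBond.tgt ∨ c'.tgt ∉ S.image PBond.src ∪ S.image PBond.tgt) ∧
        line c' (if c'.src ∉ S.image PBond.src ∪ S.image PBond.tgt then 0 else P.L - 1) = b := Classical.decPred _
  exact integral_mul_hybrid_far_eq ℰ hj hE S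
    (fun c' : PBond P (j + 1) => c'.src ∉ S.image PBond.src ∪ S.image PBond.tgt ∨ c'.tgt ∉ S.image PBond.src ∪ S.image PBond.tgt)
    (fun c' : PBond P (j + 1) => if c'.src ∉ S.image PBond.src ∪ S.image PBond.tgt then 0 else P.L - 1)
    (fun c' _ => canonical_tau_lt _ c') (canonical_far_spec hj S) ρ hρ (localOff_of_blockLocal hj _ ρ hloc) g f₂ hg hf₂ Cg C₂ hCg hC₂
    (fun V V' hVV' => hlocg V V' fun c hc => hVV' c ((not_canonicalFar_iff _ c).2 hc)) hloc₂

/-- ★★ **THE FAR-AVERAGE IDENTITY WITH THE CANONICAL FAR SET**: for `ρ` integrable, reading only the bonds issuing from `Blk(S)`, and every bounded measurable `f`: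
`∫ ρ·f(Ū^S U) dU = ∫ ρ·(A f)(Ū^S U) dU`, `A f` the average of `f` over the coarse variables of the bonds with an end block outside `Blk(S)` (written inline) — **the transported
density is a function of the coarse bonds with both end blocks in `Blk(S)`**. [cite: Balaban1985UV3, (10) p.258 + (48)–(49) p.268 (bookkeeping); Balaban1985Averaging, (15) p.19; Balaban1987RG1, (0.4) p.253] -/
theorem integral_mul_comp_hybrid_eq_canonicalFarAvg (hj : j + 1 ≤ P.m + P.K) (hE : ∀ n, Measurable fun W : Fin (n + 1) → G => ℰ.E W) (S : Finset (PBond P (j + 1)))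
    (ρ : Density P j G) (hρ : Integrable ρ (fieldMeasure P j G))
    (hloc : ∀ W W' : GaugeField P j G, (∀ b : PBond P j, blockOf b.src ∈ S.image PBond.src ∪ S.image PBond.tgt → W b = W' b) → ρ W = ρ W')
    (f : GaugeField P (j + 1) G → ℝ) (hf : Measurable f) (C : ℝ) (hC : ∀ V, |f V| ≤ C) :
    ∫ U, ρ U * f (fun c => if c ∈ S then avgFun ℰ U c else axialAvg U c) ∂(fieldMeasure P j G) =
      ∫ U, ρ U * (∫ v, f ((FibreSplit.splitEquiv
            (fun c' : PBond P (j + 1) => c'.src ∉ S.image PBond.src ∪ S.image PBond.tgt ∨ c'.tgt ∉ S.image PBond.src ∪ S.image PBond.tgt) (P := P) (G := G)).symm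
          ((FibreSplit.splitEquiv
            (fun c' : PBond P (j + 1) => c'.src ∉ S.image PBond.src ∪ S.image PBond.tgt ∨ c'.tgt ∉ S.image PBond.src ∪ S.image PBond.tgt) (P := P) (G := G)
              (fun c => if c ∈ S then avgFun ℰ U c else axialAvg U c)).1, v))
        ∂(Measure.pi fun _ : {c : PBond P (j + 1) //
            ¬¬ (c.src ∉ S.image PBond.src ∪ S.image PBond.tgt ∨ c.tgt ∉ S.image PBond.src ∪ S.image PBond.tgt)} => (HaarData.haar : Measure G)))
        ∂(fieldMeasure P j G) := by
  haveI : DecidablePred fun b : PBond P j => ∃ c' : PBond P (j + 1),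
      (c'.src ∉ S.image PBond.src ∪ S.image PBond.tgt ∨ c'.tgt ∉ S.image PBond.src ∪ S.image PBond.tgt) ∧
        line c' (if c'.src ∉ S.image PBond.src ∪ S.image PBond.tgt then 0 else P.L - 1) = b := Classical.decPred _
  exact integral_mul_comp_hybrid_eq_farAvg ℰ hj hE S
    (fun c' : PBond P (j + 1) => c'.src ∉ S.image PBond.src ∪ S.image PBond.tgt ∨ c'.tgt ∉ S.image PBond.src ∪ S.image PBond.tgt)
    (fun c' : PBond P (j + 1) => if c'.src ∉ S.image PBond.src ∪ S.image PBond.tgt then 0 else P.L - 1)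
    (fun c' _ => canonical_tau_lt _ c') (canonical_far_spec hj S) ρ hρ (localOff_of_blockLocal hj _ ρ hloc) f hf C hC

end Near

/-! ## §4 At the [B10] slot's averaging `avOfPrint N S₀ j` on `SU(N)` -/

section Slot

open Literature.MathematicalPhysics.QuantumFieldTheory.Balaban1985CMP102.Setting (Scales)
open Literature.MathematicalPhysics.QuantumFieldTheory.Balaban1983to89.ExpMeanLog (expMeanLogSU measurable_expMeanLogSU_E)
open Literature.MathematicalPhysics.QuantumFieldTheory.Balaban1983to89.Node00 (SU)

variable (N : ℕ) [NeZero N] {L : ℕ}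

/-- ★★★ **AT THE SLOT**: under the hybrid of print's averaging on `SU(N)` (every `N`, standing range), for every integrable density reading only the bonds issuing from `Blk(S)`, the
coarse variables of all bonds with an end block outside `Blk(S)` are product Haar, independent of the rest: `∫ ρ·g(Ū^S)·f₂(Ū^S) dU = (∫ ρ·g(Ū^S) dU)·(∫ f₂ dV)`.
[cite: Balaban1985UV3, (2) p.256 + (10) p.258; Balaban1985Averaging, (15) p.19; Balaban1987RG1, (0.4) p.253 (bookkeeping)] -/
theorem integral_mul_hybrid_canonicalFar_eq_avOfPrint (S₀ : Scales L) {j : ℕ} (hj : j + 1 ≤ S₀.P.m + S₀.P.K) [DecidableEq (PBond S₀.P (j + 1))]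
    (S : Finset (PBond S₀.P (j + 1))) (ρ : Density S₀.P j (SU N)) (hρ : Integrable ρ (fieldMeasure S₀.P j (SU N)))
    (hloc : ∀ W W' : GaugeField S₀.P j (SU N), (∀ b : PBond S₀.P j, blockOf b.src ∈ S.image PBond.src ∪ S.image PBond.tgt → W b = W' b) → ρ W = ρ W')
    (g f₂ : GaugeField S₀.P (j + 1) (SU N) → ℝ) (hg : Measurable g) (hf₂ : Measurable f₂) (Cg C₂ : ℝ) (hCg : ∀ V, |g V| ≤ Cg) (hC₂ : ∀ V, |f₂ V| ≤ C₂)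
    (hlocg : ∀ V V' : GaugeField S₀.P (j + 1) (SU N),
      (∀ c, c.src ∈ S.image PBond.src ∪ S.image PBond.tgt ∧ c.tgt ∈ S.image PBond.src ∪ S.image PBond.tgt → V c = V' c) → g V = g V')
    (hloc₂ : ∀ V V' : GaugeField S₀.P (j + 1) (SU N),
      (∀ c, (c.src ∉ S.image PBond.src ∪ S.image PBond.tgt ∨ c.tgt ∉ S.image PBond.src ∪ S.image PBond.tgt) → V c = V' c) → f₂ V = f₂ V') :
    ∫ U, ρ U * (g (fun c => if c ∈ S then avgFun (expMeanLogSU : LoopAverage (SU N)) U c else axialAvg U c) *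
        f₂ (fun c => if c ∈ S then avgFun (expMeanLogSU : LoopAverage (SU N)) U c else axialAvg U c)) ∂(fieldMeasure S₀.P j (SU N)) =
      (∫ U, ρ U * g (fun c => if c ∈ S then avgFun (expMeanLogSU : LoopAverage (SU N)) U c else axialAvg U c) ∂(fieldMeasure S₀.P j (SU N))) *
        ∫ V, f₂ V ∂(fieldMeasure S₀.P (j + 1) (SU N)) :=
  integral_mul_hybrid_canonicalFar_eq (expMeanLogSU : LoopAverage (SU N)) hj measurable_expMeanLogSU_E S ρ hρ hloc g f₂ hg hf₂ Cg C₂ hCg hC₂ hlocg hloc₂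

end Slot

end Summit.QuantumFields.YangMills.BalabanUVNodes.N08HaarCompatibilityGuardHybridNearBlocks

end
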